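import Mathlib
import Literature.Analysis.ODE.PicardForcing
import Literature.Analysis.FluidPDE.Tao2016AveragedNS.RestartedCascadeFlows
import HarnessLib

/-!
# `GappedFrontRobust`, tools for the (step) clause: STEP TRANSFER, time-Lipschitz amplitudes and the
  defect Grönwall bound for energies (helper for item stmt-NavierStokesRegularity-20423, crux K_B of
  routes TaoLadderRungThree / TaoLadderRungTwo / TaoLadderRungTwoPoly and its announced restatement
  over `GapData₂`)

HONEST FRAMING: elementary bookkeeping about Tao-type MODEL lattice pseudo-flows (Tao 2016, §4 Lemma 4.1
(4.8), (4.10); §6.4 Prop. 6.5, the shape of one checkpoint step), in the cell vocabulary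
`TaoCascade.PseudoFlowOn` / `StepTo` / `ballDesc` / `epochEnvelope` of the tree module
`RestartedCascadeFlows`. Nothing here is a statement about the Navier–Stokes equations, and nothing is
asserted about any table. Companion of `…GappedFrontRobustComparison` / `…TailEnergy` / `…TailStep`.

CONTENTS (all independent of the certificate format):
* `stepTo_transfer` — CLOSENESS TRANSFERS A STEP. If the exact flow `S` steps at time `τ₁` with amplitude
  `a` into the `ρr`-ball (clock `c₀`, ratio exponent `θ₀`), certifies its amplitude with a margin
  `a (1+σ) ≤ |S_{i₀,1}(τ₁)|`, and a second family `S'` is close to `S` at time `τ₁` —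
  `|S'_{i₀,1} − S_{i₀,1}| ≤ σ a` at the observable mode and `w_k |S'_{1+k} − S_{1+k}| ≤ (1−ρ) r a` in the
  weighted norm — with energies `F'` under an envelope `env` throughout `[0, τ₁]`, then `S'` steps at the
  SAME `(τ₁, a)` into the `r`-ball with the relaxed constants `θ ≥ θ₀`, `c ≥ c₀` and the envelope `env`.
  (This is the last line of any proof of `RobustStep` from gap data; the amplitude margin `σ` is the
  hinge H3 of the K_B restatement memos.)
* `pseudoFlowOn_abs_derivWithin_le`, `pseudoFlowOn_abs_sub_le` — amplitudes of a pseudo-flow are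
  Lipschitz in time on `[0, τ]` with constant `sup (|quadTerm| + κ₁ (1+ε₀)^{2k} √F)` (mean value
  inequality for the one-sided derivative; feeds the uniform-Lipschitz hypothesis of `bootstrap_family`).
* `pseudoFlowOn_energy_le_exp` — the DEFECT GRÖNWALL bound: if `½ S_{i,k}² ≤ Ā` on `[0, s]` then
  `F_{i,k}(u) ≤ (Ā + B₀_{i,k}) exp(κ₂ (1+ε₀)^{2k} u)` on `[0, s]` ((4.10) upper half and the tree's
  integral Grönwall lemma `Literature.Analysis.ODE.le_mul_exp_of_le_add_mul_integral_Icc`): amplitude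
  control of a pseudo-flow is energy control up to slack and an `exp(κ₂ (1+ε₀)^{2k} s)` factor.
-/

noncomputable section

-- the sub-problem namespace `Summit.NavierStokesRegularity.NavierStokesRegularity` repeats the summit name by design (D-0017)
set_option linter.dupNamespace false

namespace Summit.NavierStokesRegularity.NavierStokesRegularity.Theorems

open Set MeasureTheory intervalIntegral Literature.Analysis.FluidPDE Literature.Analysis.FluidPDE.TaoCascade

namespace GappedFrontRobust

variable {m : ℕ}

/-! ### Closeness transfers a step -/

/-- **STEP TRANSFER.** Let `S, F` step at `(τ₁, a)`:
`StepTo ε₀ θ₀ c₀ i₀ (ballDesc Z w (ρ r)) (epochEnvelope env₀) S F τ₁ a`, with the amplitude certified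
with margin `a (1 + σ) ≤ |S_{i₀,1}(τ₁)|`. Let `S', F'` satisfy, at time `τ₁`,
`|S'_{i₀,1} − S_{i₀,1}| ≤ σ a` and `w_k |S'_{i,1+k} − S_{i,1+k}| ≤ (1 − ρ) r a` for all `i, k` (weights
`w ≥ 0`), and `F'_{i,k}(s) ≤ env k` for `s ∈ [0, τ₁]`. Then for all `θ ≥ θ₀`, `c ≥ c₀` (`ε₀ ≥ 0`):
`StepTo ε₀ θ c i₀ (ballDesc Z w r) (epochEnvelope env) S' F' τ₁ a`.
[cite: Tao2016AveragedNS, §6.4 Prop. 6.5 (conclusion shape); cell vocabulary] -/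
theorem stepTo_transfer {ε₀ θ₀ θ c₀ c : ℝ} {i₀ : Fin m} {Z : Set (Fin m → ℤ → ℝ)} {w : ℤ → ℝ}
    {r ρ σ : ℝ} {env₀ env : ℤ → ℝ} {S F S' F' : Fin m → ℤ → ℝ → ℝ} {τ₁ a : ℝ}
    (hε : 0 ≤ ε₀) (hθ : θ₀ ≤ θ) (hc : c₀ ≤ c) (hw : ∀ k, 0 ≤ w k)
    (hstep : StepTo ε₀ θ₀ c₀ i₀ (ballDesc Z w (ρ * r)) (epochEnvelope env₀) S F τ₁ a)
    (hmargin : a * (1 + σ) ≤ |S i₀ 1 τ₁|)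
    (hfront : |S' i₀ 1 τ₁ - S i₀ 1 τ₁| ≤ σ * a)
    (hball : ∀ i k, w k * |S' i (1 + k) τ₁ - S i (1 + k) τ₁| ≤ (1 - ρ) * r * a)
    (henv : ∀ s ∈ Icc 0 τ₁, ∀ i k, F' i k s ≤ env k) :
    StepTo ε₀ θ c i₀ (ballDesc Z w r) (epochEnvelope env) S' F' τ₁ a := by
  obtain ⟨hτ₁, hτ₁c, ha, haθ, _haS, ⟨z, hz, hzball⟩, _hep⟩ := hstep
  refine ⟨hτ₁, hτ₁c.trans hc, ha, ?_, ?_, ⟨z, hz, fun i k => ?_⟩, fun s hs i k => henv s hs i k⟩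
  · -- ratio: (1+ε₀)^{-θ} ≤ (1+ε₀)^{-θ₀} ≤ a
    exact (Real.rpow_le_rpow_of_exponent_le (by linarith) (by linarith)).trans haθ
  · -- amplitude: |S'| ≥ |S| - |S' - S| ≥ a(1+σ) - σ a = a
    have h1 : |S i₀ 1 τ₁| - |S' i₀ 1 τ₁ - S i₀ 1 τ₁| ≤ |S' i₀ 1 τ₁| := by
      have := abs_sub_abs_le_abs_sub (S i₀ 1 τ₁) (S' i₀ 1 τ₁)
      rw [abs_sub_comm] at this
      linarith
    nlinarith
  · -- ball: w_k |S'/a - z| ≤ w_k |S' - S|/a + w_k |S/a - z| ≤ (1-ρ) r + ρ r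
    have hzk := hzball i k
    have hbk := hball i k
    have htri : |S' i (1 + k) τ₁ / a - z i k| ≤
        |S' i (1 + k) τ₁ - S i (1 + k) τ₁| / a + |S i (1 + k) τ₁ / a - z i k| := by
      have := abs_sub_le (S' i (1 + k) τ₁ / a) (S i (1 + k) τ₁ / a) (z i k)
      rw [← sub_div, abs_div, abs_of_pos ha] at this
      exact this
    have h2 : w k * (|S' i (1 + k) τ₁ - S i (1 + k) τ₁| / a) ≤ (1 - ρ) * r := by
      rw [← mul_div_assoc, div_le_iff₀ ha]
      exact hbk
    calc w k * |S' i (1 + k) τ₁ / a - z i k|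
        ≤ w k * (|S' i (1 + k) τ₁ - S i (1 + k) τ₁| / a + |S i (1 + k) τ₁ / a - z i k|) :=
          mul_le_mul_of_nonneg_left htri (hw k)
      _ = w k * (|S' i (1 + k) τ₁ - S i (1 + k) τ₁| / a) + w k * |S i (1 + k) τ₁ / a - z i k| := by
          ring
      _ ≤ (1 - ρ) * r + ρ * r := add_le_add h2 hzk
      _ = r := by ring

variable {τ ε₀ : ℝ} {α : Fin m → Fin m → Fin m → ℤ × ℤ × ℤ → ℝ} {κ₁ κ₂ : ℝ}
  {S₀ F₀ B₀ : Fin m → ℤ → ℝ} {S F : Fin m → ℤ → ℝ → ℝ}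

/-! ### Amplitudes are Lipschitz in time -/

/-- **The one-sided time derivative of an amplitude is bounded by the quadratic term plus the defect**:
`|∂S_{i,k}(u)| ≤ |quadTerm(S)_{i,k}(u)| + κ₁ (1+ε₀)^{2k} √F_{i,k}(u)` on `[0, τ]` ((4.8)).
[cite: Tao2016AveragedNS, §4 Lemma 4.1 (4.8)] -/
theorem pseudoFlowOn_abs_derivWithin_le (h : PseudoFlowOn τ ε₀ α κ₁ κ₂ S₀ F₀ B₀ S F) (i : Fin m)
    (k : ℤ) {u : ℝ} (hu : u ∈ Icc 0 τ) :
    |derivWithin (S i k) (Icc 0 τ) u| ≤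
      |quadTerm ε₀ α S i k u| + κ₁ * (1 + ε₀) ^ ((2 : ℝ) * k) * Real.sqrt (F i k u) := by
  have h1 := h.motion i k u hu
  have h2 := abs_sub_abs_le_abs_sub (derivWithin (S i k) (Icc 0 τ) u) (quadTerm ε₀ α S i k u)
  linarith

/-- **Amplitudes of a pseudo-flow are Lipschitz in time.** If
`|quadTerm(S)_{i,k}(u)| + κ₁ (1+ε₀)^{2k} √F_{i,k}(u) ≤ L` on `[0, τ]`, then
`|S_{i,k}(t) − S_{i,k}(s)| ≤ L |t − s|` for `s, t ∈ [0, τ]` (mean value inequality for the derivative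
within `[0, τ]`). [cite: Tao2016AveragedNS, §4 Lemma 4.1 (4.5), (4.8)] -/
theorem pseudoFlowOn_abs_sub_le (h : PseudoFlowOn τ ε₀ α κ₁ κ₂ S₀ F₀ B₀ S F)
    (i : Fin m) (k : ℤ) {L : ℝ}
    (hL : ∀ u ∈ Icc 0 τ,
      |quadTerm ε₀ α S i k u| + κ₁ * (1 + ε₀) ^ ((2 : ℝ) * k) * Real.sqrt (F i k u) ≤ L)
    {s t : ℝ} (hs : s ∈ Icc 0 τ) (ht : t ∈ Icc 0 τ) :
    |S i k t - S i k s| ≤ L * |t - s| := by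
  have hdiff : DifferentiableOn ℝ (S i k) (Icc 0 τ) :=
    (h.contDiffOn_S i k).differentiableOn one_ne_zero
  have hbound : ∀ x ∈ Icc 0 τ, ‖derivWithin (S i k) (Icc 0 τ) x‖ ≤ L := fun x hx => by
    rw [Real.norm_eq_abs]
    exact (pseudoFlowOn_abs_derivWithin_le h i k hx).trans (hL x hx)
  have := (convex_Icc 0 τ).norm_image_sub_le_of_norm_derivWithin_le hdiff hbound hs ht
  simpa only [Real.norm_eq_abs] using this

/-! ### The defect Grönwall bound for energies -/

/-- **DEFECT GRÖNWALL.** Along a pseudo-flow on `[0, τ]` with slack constant `κ₂ ≥ 0` (`ε₀ > −1`), if the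
kinetic part is bounded on an initial segment, `½ S_{i,k}(u)² ≤ Ā` for `u ∈ [0, s]` (`s ≤ τ`), then
`F_{i,k}(u) ≤ (Ā + B₀_{i,k}) exp(κ₂ (1+ε₀)^{2k} u)` for `u ∈ [0, s]`: by (4.10),
`F ≤ ½S² + B₀ + κ₂ (1+ε₀)^{2k} ∫₀ F ≤ (Ā + B₀) + κ₂ (1+ε₀)^{2k} ∫₀ F`, and the integral Grönwall lemma
applies. [cite: Tao2016AveragedNS, §4 Lemma 4.1 (4.10)] -/
theorem pseudoFlowOn_energy_le_exp (h : PseudoFlowOn τ ε₀ α κ₁ κ₂ S₀ F₀ B₀ S F) (hε : 0 < 1 + ε₀)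
    (hκ₂ : 0 ≤ κ₂) (i : Fin m) (k : ℤ) {s Ā : ℝ} (hs : s ∈ Icc 0 τ)
    (hA : ∀ u ∈ Icc 0 s, (1 / 2) * S i k u ^ 2 ≤ Ā) :
    ∀ u ∈ Icc 0 s, F i k u ≤ (Ā + B₀ i k) * Real.exp (κ₂ * (1 + ε₀) ^ ((2 : ℝ) * k) * u) := by
  have hsubI : Icc 0 s ⊆ Icc 0 τ := Icc_subset_Icc_right hs.2
  have hFc : ContinuousOn (F i k) (Icc 0 s) := (h.contDiffOn_F i k).continuousOn.mono hsubI
  have hK : 0 ≤ κ₂ * (1 + ε₀) ^ ((2 : ℝ) * k) := mul_nonneg hκ₂ (Real.rpow_pos_of_pos hε _).le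
  have hineq : ∀ u ∈ Icc 0 s, F i k u ≤ (Ā + B₀ i k) +
      κ₂ * (1 + ε₀) ^ ((2 : ℝ) * k) * ∫ v in (0 : ℝ)..u, F i k v := by
    intro u hu
    have h1 := h.defect_upper i k u (hsubI hu)
    have h2 := hA u hu
    linarith
  exact Literature.Analysis.ODE.le_mul_exp_of_le_add_mul_integral_Icc hFc hK hineq

/-! ### Structural lemmas for pseudo-flows (appended by p1 g9): shrinking the horizon, enlarging the
defect constants, and the uniform amplitude bound from (4.5) -/

/-- **Shrinking the horizon**: a pseudo-flow on `[0, τ]` is a pseudo-flow on `[0, τ']` for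
`0 < τ' ≤ τ`, with the same table, defect constants, start data and slack (the one-sided derivatives
within `[0, τ']` and `[0, τ]` agree on `[0, τ']`, tree lemma `derivWithin_Icc_eq_derivWithin_Icc`).
Used to put the exact flow (horizon `c`) and a pseudo-flow (horizon `τ ≥ c`) on the common window
`[0, τ₁]` of a step. [cite: Tao2016AveragedNS, §4 Lemma 4.1 (4.5), (4.8)–(4.10)] -/
theorem pseudoFlowOn_mono (h : PseudoFlowOn τ ε₀ α κ₁ κ₂ S₀ F₀ B₀ S F) {τ' : ℝ} (hτ' : 0 < τ')
    (hle : τ' ≤ τ) : PseudoFlowOn τ' ε₀ α κ₁ κ₂ S₀ F₀ B₀ S F where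
  contDiffOn_S i k := (h.contDiffOn_S i k).mono (Icc_subset_Icc_right hle)
  contDiffOn_F i k := (h.contDiffOn_F i k).mono (Icc_subset_Icc_right hle)
  nonneg_F i k s hs := h.nonneg_F i k s ⟨hs.1, hs.2.trans hle⟩
  apriori_S := by
    obtain ⟨M, hM⟩ := h.apriori_S
    exact ⟨M, fun s hs i k => hM s ⟨hs.1, hs.2.trans hle⟩ i k⟩
  apriori_F := by
    obtain ⟨M, hM⟩ := h.apriori_F
    exact ⟨M, fun s hs i k => hM s ⟨hs.1, hs.2.trans hle⟩ i k⟩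
  init_S := h.init_S
  init_F := h.init_F
  motion i k s hs := by
    rw [derivWithin_Icc_eq_derivWithin_Icc (h.contDiffOn_S i k) hτ' hle hs]
    exact h.motion i k s ⟨hs.1, hs.2.trans hle⟩
  energy i k s hs := by
    rw [derivWithin_Icc_eq_derivWithin_Icc (h.contDiffOn_F i k) hτ' hle hs]
    exact h.energy i k s ⟨hs.1, hs.2.trans hle⟩
  defect_lower i k s hs := h.defect_lower i k s ⟨hs.1, hs.2.trans hle⟩
  defect_upper i k s hs := h.defect_upper i k s ⟨hs.1, hs.2.trans hle⟩

/-- **Enlarging the defect constants**: a `(κ₁, κ₂)`-pseudo-flow is a `(κ₁', κ₂')`-pseudo-flow for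
`κ₁ ≤ κ₁'`, `κ₂ ≤ κ₂'` (`ε₀ > -1`; the energies are nonnegative, so the (4.10)-integral is). In
particular an exact flow is an `(η, η)`-pseudo-flow for every `η ≥ 0`.
[cite: Tao2016AveragedNS, §4 Lemma 4.1 (4.8), (4.10)] -/
theorem pseudoFlowOn_of_le_defects (h : PseudoFlowOn τ ε₀ α κ₁ κ₂ S₀ F₀ B₀ S F) (hε : 0 < 1 + ε₀)
    {κ₁' κ₂' : ℝ} (h₁ : κ₁ ≤ κ₁') (h₂ : κ₂ ≤ κ₂') : PseudoFlowOn τ ε₀ α κ₁' κ₂' S₀ F₀ B₀ S F where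
  contDiffOn_S := h.contDiffOn_S
  contDiffOn_F := h.contDiffOn_F
  nonneg_F := h.nonneg_F
  apriori_S := h.apriori_S
  apriori_F := h.apriori_F
  init_S := h.init_S
  init_F := h.init_F
  motion i k s hs := by
    refine (h.motion i k s hs).trans ?_
    have hw : 0 ≤ (1 + ε₀) ^ ((2 : ℝ) * k) * Real.sqrt (F i k s) :=
      mul_nonneg (Real.rpow_pos_of_pos hε _).le (Real.sqrt_nonneg _)
    nlinarith
  energy := h.energy
  defect_lower := h.defect_lower
  defect_upper i k s hs := by
    refine (h.defect_upper i k s hs).trans ?_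
    have hF : 0 ≤ ∫ u in (0 : ℝ)..s, F i k u :=
      intervalIntegral.integral_nonneg hs.1 fun u hu => h.nonneg_F i k u ⟨hu.1, hu.2.trans hs.2⟩
    have hw : 0 ≤ (1 + ε₀) ^ ((2 : ℝ) * k) * ∫ u in (0 : ℝ)..s, F i k u :=
      mul_nonneg (Real.rpow_pos_of_pos hε _).le hF
    nlinarith

/-- **Uniform amplitude and energy bounds from (4.5)**: along a pseudo-flow (`ε₀ > -1`) there is
`M ≥ 0` with `|S_{i,k}(s)| ≤ M`, `|S_{i,k}(s)| ≤ M (1+ε₀)^{-10k}`, `√F_{i,k}(s) ≤ M` and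
`√F_{i,k}(s) ≤ M (1+ε₀)^{-10k}` for all modes, shells and `s ∈ [0, τ]` (the constants of the two
a priori fields merged). [cite: Tao2016AveragedNS, §4 Lemma 4.1 (4.5)] -/
theorem pseudoFlowOn_uniform_bounds (h : PseudoFlowOn τ ε₀ α κ₁ κ₂ S₀ F₀ B₀ S F) (hε : 0 < 1 + ε₀) :
    ∃ M : ℝ, 0 ≤ M ∧ ∀ s ∈ Icc 0 τ, ∀ (i : Fin m) (k : ℤ),
      |S i k s| ≤ M ∧ |S i k s| ≤ M * (1 + ε₀) ^ (-(10 : ℝ) * k) ∧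
        Real.sqrt (F i k s) ≤ M ∧ Real.sqrt (F i k s) ≤ M * (1 + ε₀) ^ (-(10 : ℝ) * k) := by
  obtain ⟨M₁, hM₁⟩ := h.apriori_S
  obtain ⟨M₂, hM₂⟩ := h.apriori_F
  refine ⟨max (max M₁ M₂) 0, le_max_right _ _, fun s hs i k => ?_⟩
  have hw : 0 ≤ 1 + (1 + ε₀) ^ ((10 : ℝ) * k) := by
    have := Real.rpow_pos_of_pos hε ((10 : ℝ) * k)
    linarith
  have hq : 0 < (1 + ε₀) ^ ((10 : ℝ) * k) := Real.rpow_pos_of_pos hε _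
  have hneg : (1 + ε₀) ^ (-(10 : ℝ) * k) = ((1 + ε₀) ^ ((10 : ℝ) * k))⁻¹ := by
    rw [show -(10 : ℝ) * k = -((10 : ℝ) * k) by ring, Real.rpow_neg hε.le]
  -- generic: weight bound ⇒ the two bounds
  have gen : ∀ x : ℝ, 0 ≤ x → (1 + (1 + ε₀) ^ ((10 : ℝ) * k)) * x ≤ max (max M₁ M₂) 0 →
      x ≤ max (max M₁ M₂) 0 ∧ x ≤ max (max M₁ M₂) 0 * (1 + ε₀) ^ (-(10 : ℝ) * k) := by
    intro x hx hb
    refine ⟨by nlinarith, ?_⟩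
    rw [hneg, ← div_eq_mul_inv, le_div_iff₀ hq]
    nlinarith
  have hS := gen |S i k s| (abs_nonneg _) ((hM₁ s hs i k).trans
    ((le_max_left _ _).trans (le_max_left _ _)))
  have hF := gen (Real.sqrt (F i k s)) (Real.sqrt_nonneg _) ((hM₂ s hs i k).trans
    ((le_max_right _ _).trans (le_max_left _ _)))
  exact ⟨hS.1, hS.2, hF.1, hF.2⟩

end GappedFrontRobust

end Summit.NavierStokesRegularity.NavierStokesRegularity.Theorems

end
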